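import Summits.QuantumFields.YangMills.Theorems.ColdStartUniversalityLatticeLangevinBlockLoopMixing
import Summits.QuantumFields.YangMills.Theorems.ColdStartUniversalityUniformColdStartMixingNearUniformLoopStrings
import HarnessLib

/-!
# Route `ColdStartUniversality` (fixed-cut-off package / LINE 4 reading): BLOCK-AVERAGED LOOP STRINGS — the crux's observable shape
# `∏_(C∈os)` of LOCAL (block-averaged) loops — from log-Sobolev(`ρ`) and under (ULS) alone

Helper file (seat `ym-line-csu-p1`, g28; `--supports stmt-QuantumFields-24809`).  The crux `UniformColdStartMixing` tests PRODUCTS of UNIT-BLOCK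
averaged loop observables.  Smooth version: for a nonempty set `B` of base points and rectangles `(i_k, j_k, R_k × T_k)_(k<m)` put
`W̄_(B,k) = (#B)⁻¹ Σ_(x∈B) W_(R_k×T_k)(x; i_k, j_k)`.  Product rule (`carre_prod_le`) + sparsity-aware block carré (`wilson_blockLoopAverage_carre_le`):
* `abs_blockLoopAverage_le_one`; ★★ `wilson_blockLoopString_carre_le` — `Γ(∏_k W̄_(B,k)) ≤ 32(Σ_k(R_k+T_k))²/#B`;
* ★★ `wilson_coldStart_blockLoopString_le_exp_of_logSobolev` / `…_le_blocks_of_logSobolev` — under a HYPOTHESIS log-Sobolev(`ρ`) (every `β'`):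
  `|E ∏_k W̄_(B,k)(U_(2+u)) − ∫∏_k W̄_(B,k) dμ_(β')| ≤ e^(−2ρu)·(Σ_k(R_k+T_k))·√(16(366|β'|+3)(L³/#B)/ρ)`;
* ★★★ `wilson_coldStart_blockLoopString_le_blocks` — at `|β'| < 1/12` UNCONDITIONALLY (g26's uniform log-Sobolev, `ρ = (1−12|β'|)/2`):
  `≤ e^(−(1−12|β'|)u)·(Σ_k(R_k+T_k))·√(32(366|β'|+3)(L³/#B)/(1−12|β'|))`;
* ★★★ `nearUniform_blockLoopString_coldStart_of_uniformLogSobolev` — under (ULS): at every `K ≥ K₀`, every nonempty block `B`, every solution at `β'_K`: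
  `≤ e^(−2cε_K u)·(Σ_k(R_k+T_k))·√(16(366β'_K+3)(L_K³/#B)/(cε_K))` — with unit PHYSICAL blocks `L_K³/#B = ℓ³` is FIXED, so the threshold is again
  `O(log(1/ε_K))` in physical time (two logs for loops of fixed physical size `R_k+T_k ≍ ε_K⁻¹`).
PLANNER-FACING, HONEST: smooth `½Re tr` block averages, NOT Bałaban's `avgObs expMeanLogSU` (piecewise); (ULS) is K-UNIFORM and OPEN; nothing K-uniform
is proved; 24809 ASIDE not restated; no crux, rung or summit statement is proved; the Yang–Mills mass gap is NOT proved.  THEOREMS ONLY, no definition,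
no sorry. [cite: BakryGentilLedoux2014, Thm 5.2.1]
-/

set_option autoImplicit false

noncomputable section

namespace Summit.QuantumFields.YangMills.Theorems.ColdStartUniversality

open MeasureTheory ProbabilityTheory Finset Filter Set InformationTheory
open scoped BigOperators NNReal ENNReal Topology Matrix
open Literature.Probability.Process Literature.MathematicalPhysics.QuantumFieldTheory
open Literature.MathematicalPhysics.QuantumLattice (fundamentalRep fundamentalLatticeRep continuous_fundamentalRep)
open Literature.MathematicalPhysics.QuantumFieldTheory.Balaban1983to89

variable {L : ℕ} [NeZero L]

/-! ## §1. The carré du champ of a block-averaged loop string -/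

omit [NeZero L] in
/-- `|W̄_B| ≤ 1` for the block average `W̄_B = (#B)⁻¹ Σ_(x∈B) W_(R×T)(x; i, j)` (`B` nonempty). [folklore] -/
theorem abs_blockLoopAverage_le_one (i j : Fin 3) (R T : ℕ) (B : Finset (Site 3 L)) (hB : B.Nonempty)
    (V : (GaugeConfig 3 L (Matrix.specialUnitaryGroup (Fin 2) ℂ))) :
    |((B.card : ℝ))⁻¹ * ∑ x ∈ B, wilsonLoop (fundamentalRep (Fin 2)) x i j R T V| ≤ 1 := by
  have hS : (0 : ℝ) < (B.card : ℝ) := by exact_mod_cast hB.card_pos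
  rw [abs_mul, abs_inv, abs_of_pos hS]
  calc ((B.card : ℝ))⁻¹ * |∑ x ∈ B, wilsonLoop (fundamentalRep (Fin 2)) x i j R T V|
      ≤ ((B.card : ℝ))⁻¹ * ∑ x ∈ B, |wilsonLoop (fundamentalRep (Fin 2)) x i j R T V| :=
        mul_le_mul_of_nonneg_left (Finset.abs_sum_le_sum_abs _ _) (inv_nonneg.2 hS.le)
    _ ≤ ((B.card : ℝ))⁻¹ * ∑ _x ∈ B, (1 : ℝ) :=
        mul_le_mul_of_nonneg_left (Finset.sum_le_sum fun x _ => abs_wilsonLoop_two_le_one x i j R T V) (inv_nonneg.2 hS.le)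
    _ = 1 := by rw [Finset.sum_const, nsmul_eq_mul, mul_one, inv_mul_cancel₀ hS.ne']

/-- ★★ **Carré du champ of a block-averaged loop string**: `Γ(∏_k W̄_(B,k))(V) ≤ 32·(Σ_k (R_k + T_k))²/#B` at every configuration (`B` nonempty).
[cite: ShenZhuZhu2022, §3 Lemma 3.1] -/
theorem wilson_blockLoopString_carre_le (L : ℕ) [NeZero L] (β' : ℝ) (m : ℕ) (i j : Fin m → Fin 3) (R T : Fin m → ℕ)
    (B : Finset (Site 3 L)) (hB : B.Nonempty) :
    let coords : GaugeConfig 3 L (Matrix.specialUnitaryGroup (Fin 2) ℂ) → (Edge 3 L × Fin 2 × Fin 2 × Bool → ℝ) :=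
      fun V q => (fun z : ℂ => if q.2.2.2 then z.im else z.re)
        ((fundamentalRep (Fin 2) (V q.1) : Matrix (Fin 2) (Fin 2) ℂ) q.2.1 q.2.2.1)
    let A : GaugeConfig 3 L (Matrix.specialUnitaryGroup (Fin 2) ℂ) → (Edge 3 L × Fin 2 × Fin 2 × Bool) →
        (Edge 3 L × Fin 2 × Fin 2 × Bool) → ℝ := fun V i j =>
      ∑ n : Edge 3 L × NoiseIdx 2,
        (if n.1 = i.1 then (fun z : ℂ => if i.2.2.2 then z.im else z.re)
          ((latticeLangevinDynamics (fundamentalLatticeRep 2) β').noise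
            (matrixConfig (fundamentalRep (Fin 2)) V) i.1 n.2 i.2.1 i.2.2.1) else 0) *
        (if n.1 = j.1 then (fun z : ℂ => if j.2.2.2 then z.im else z.re)
          ((latticeLangevinDynamics (fundamentalLatticeRep 2) β').noise
            (matrixConfig (fundamentalRep (Fin 2)) V) j.1 n.2 j.2.1 j.2.2.1) else 0)
    ∀ V : (GaugeConfig 3 L (Matrix.specialUnitaryGroup (Fin 2) ℂ)),
      (∑ a : Edge 3 L × Fin 2 × Fin 2 × Bool, ∑ b : Edge 3 L × Fin 2 × Fin 2 × Bool,
        fderiv ℝ (fun y => ∏ k : Fin m, (fun y : (Edge 3 L × Fin 2 × Fin 2 × Bool → ℝ) => (2 * (B.card : ℝ))⁻¹ * ∑ x ∈ B, ((((((List.range (R k)).map (fun m : ℕ => ((Pi.single (i k) ((m : ℕ) : ZMod L) : Site 3 L), (i k), false)) ++ (List.range (T k)).map (fun m : ℕ => ((Pi.single (i k) (((R k) : ℕ) : ZMod L) : Site 3 L) + (Pi.single (j k) ((m : ℕ) : ZMod L) : Site 3 L), (j k), false)) ++ ((List.range (R k)).map (fun m : ℕ => ((Pi.single (j k) (((T k)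 : ℕ) : ZMod L) : Site 3 L) + (Pi.single (i k) ((m : ℕ) : ZMod L) : Site 3 L), (i k), true))).reverse ++ ((List.range (T k)).map (fun m : ℕ => ((Pi.single (j k) ((m : ℕ) : ZMod L) : Site 3 L), (j k), true))).reverse).map (fun q : Site 3 L × Fin 3 × Bool => ((x + q.1, q.2.1), q.2.2))).map (fun a : Edge 3 L × Bool => if a.2 then ((fun (ee : Edge 3 L) => Matrix.of fun (i' j' : Fin 2) => ((y (ee, i', j', false) : ℝ) : ℂ) + ((y (ee, i', j', true) : ℝ) : ℂ) * Complex.I) a.1)ᴴ else (fun (ee : Edge 3 L) => Matrix.of fun (i' j' : Fin 2) => ((y (ee, i', j', false) : ℝ) : ℂ) + ((y (ee, i', j', true) : ℝ) : ℂ) * Complex.I) a.1)).prod)).trace.re) y) (coords V) (Pi.single a 1) *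
        fderiv ℝ (fun y => ∏ k : Fin m, (fun y : (Edge 3 L × Fin 2 × Fin 2 × Bool → ℝ) => (2 * (B.card : ℝ))⁻¹ * ∑ x ∈ B, ((((((List.range (R k)).map (fun m : ℕ => ((Pi.single (i k) ((m : ℕ) : ZMod L) : Site 3 L), (i k), false)) ++ (List.range (T k)).map (fun m : ℕ => ((Pi.single (i k) (((R k) : ℕ) : ZMod L) : Site 3 L) + (Pi.single (j k) ((m : ℕ) : ZMod L) : Site 3 L), (j k), false)) ++ ((List.range (R k)).map (fun m : ℕ => ((Pi.single (j k) (((T k) : ℕ) : ZMod L) : Site 3 L) + (Pi.single (i k) ((m : ℕ) : ZMod L) : Site 3 L), (i k), true))).reverse ++ ((List.range (T k)).map (fun m : ℕ => ((Pi.single (j k) ((m : ℕ) : ZMod L) : Site 3 L), (j k), true))).reverse).map (fun q : Site 3 L × Fin 3 × Bool => ((x + q.1, q.2.1), q.2.2))).map (fun a : Edge 3 L × Bool => if a.2 then ((fun (ee : Edge 3 L) => Matrix.of fun (i' j' : Fin 2) => ((y (ee, i', j', false) : ℝ) : ℂ) + ((y (ee, i', j', true) : ℝ) : ℂ) * Complex.I)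 a.1)ᴴ else (fun (ee : Edge 3 L) => Matrix.of fun (i' j' : Fin 2) => ((y (ee, i', j', false) : ℝ) : ℂ) + ((y (ee, i', j', true) : ℝ) : ℂ) * Complex.I) a.1)).prod)).trace.re) y) (coords V) (Pi.single b 1) * A V a b) ≤
        32 * (∑ k : Fin m, ((R k : ℝ) + T k)) ^ 2 / (B.card : ℝ) := by
  intro coords A V
  classical
  have hS : (0 : ℝ) < (B.card : ℝ) := by exact_mod_cast hB.card_pos
  have hS0 : (B.card : ℝ) ≠ 0 := hS.ne'
  set F : Fin m → (Edge 3 L × Fin 2 × Fin 2 × Bool → ℝ) → ℝ := fun k => (fun y : (Edge 3 L × Fin 2 × Fin 2 × Bool → ℝ) => (2 * (B.card : ℝ))⁻¹ * ∑ x ∈ B, ((((((List.range (R k)).map (fun m : ℕ => ((Pi.single (i k) ((m : ℕ) : ZMod L) : Site 3 L), (i k), false)) ++ (List.range (T k)).map (fun m : ℕ => ((Pi.single (i k) (((R k) : ℕ) : ZMod L) : Site 3 L) + (Pi.single (j k) ((m : ℕ) : ZMod L) : Site 3 L), (j k), false)) ++ ((List.range (R k)).map (fun m : ℕ => ((Pi.single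 (j k) (((T k) : ℕ) : ZMod L) : Site 3 L) + (Pi.single (i k) ((m : ℕ) : ZMod L) : Site 3 L), (i k), true))).reverse ++ ((List.range (T k)).map (fun m : ℕ => ((Pi.single (j k) ((m : ℕ) : ZMod L) : Site 3 L), (j k), true))).reverse).map (fun q : Site 3 L × Fin 3 × Bool => ((x + q.1, q.2.1), q.2.2))).map (fun a : Edge 3 L × Bool => if a.2 then ((fun (ee : Edge 3 L) => Matrix.of fun (i' j' : Fin 2) => ((y (ee, i', j', false) : ℝ) : ℂ) + ((y (ee, i', j', true) : ℝ) : ℂ) * Complex.I) a.1)ᴴ else (fun (ee : Edge 3 L) => Matrix.of fun (i' j' : Fin 2) => ((y (ee, i', j', false) : ℝ) : ℂ) + ((y (ee, i', j', true) : ℝ) : ℂ) * Complex.I) a.1)).prod)).trace.re) with hFdef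
  have hF : ∀ k, ContDiff ℝ 1 (F k) := fun k => contDiff_blockLoopAverage _ _ B
  have hlen : ∀ k, (((((List.range (R k)).map (fun m : ℕ => ((Pi.single (i k) ((m : ℕ) : ZMod L) : Site 3 L), (i k), false)) ++ (List.range (T k)).map (fun m : ℕ => ((Pi.single (i k) (((R k) : ℕ) : ZMod L) : Site 3 L) + (Pi.single (j k) ((m : ℕ) : ZMod L) : Site 3 L), (j k), false)) ++ ((List.range (R k)).map (fun m : ℕ => ((Pi.single (j k) (((T k) : ℕ) : ZMod L) : Site 3 L) + (Pi.single (i k) ((m : ℕ) : ZMod L) : Site 3 L), (i k), true))).reverse ++ ((List.range (T k)).map (fun m : ℕ => ((Pi.single (j k) ((m : ℕ) : ZMod L) : Site 3 L), (j k), true))).reverse)).length : ℕ) : ℝ) = 2 * ((R k : ℝ) + T k) := by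
    intro k; rw [rectShape_length]; push_cast; ring
  have hval : ∀ k, F k (coords V) = (((B.card : ℝ))⁻¹ * ∑ x ∈ B, wilsonLoop (fundamentalRep (Fin 2)) x (i k) (j k) (R k) (T k) V) :=
    fun k => blockLoopAverage_coords_eq V (i k) (j k) (R k) (T k) B hB
  have hb : ∀ k, |F k (coords V)| ≤ 1 := fun k => by rw [hval]; exact abs_blockLoopAverage_le_one (i k) (j k) (R k) (T k) B hB V
  set a : Fin m → ℝ := fun k => Real.sqrt (32 / (B.card : ℝ)) * ((R k : ℝ) + T k) with hadef
  have ha : ∀ k, 0 ≤ a k := fun k => mul_nonneg (Real.sqrt_nonneg _) (by positivity)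
  have hΓk : ∀ k, (∑ a' : Edge 3 L × Fin 2 × Fin 2 × Bool, ∑ b' : Edge 3 L × Fin 2 × Fin 2 × Bool,
      fderiv ℝ (F k) (coords V) (Pi.single a' 1) * fderiv ℝ (F k) (coords V) (Pi.single b' 1) * A V a' b') ≤ a k ^ 2 := by
    intro k
    have hak : a k ^ 2 = 32 / (B.card : ℝ) * ((R k : ℝ) + T k) ^ 2 := by
      simp only [hadef]
      rw [mul_pow, Real.sq_sqrt (div_nonneg (by norm_num) hS.le)]
    have h := wilson_blockLoopAverage_carre_le L β' ((List.range (R k)).map (fun m : ℕ => ((Pi.single (i k) ((m : ℕ) : ZMod L) : Site 3 L), (i k), false)) ++ (List.range (T k)).map (fun m : ℕ => ((Pi.single (i k) (((R k) : ℕ) : ZMod L) : Site 3 L) + (Pi.single (j k) ((m : ℕ) : ZMod L) : Site 3 L), (j k), false)) ++ ((List.range (R k)).map (fun m : ℕ => ((Pi.single (j k) (((T k) : ℕ) : ZMod L) : Site 3 L) + (Pi.single (i k) ((m : ℕ) : ZMod L) : Site 3 L), (i k), true))).reverse ++ ((List.range (T k)).map (fun m : ℕ => ((Pi.single (j k) ((m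 : ℕ) : ZMod L) : Site 3 L), (j k), true))).reverse) ((2 * (B.card : ℝ))⁻¹) B V
    refine h.trans (le_of_eq ?_)
    rw [hlen k, hak]
    field_simp
  have hmain := carre_prod_le L β' m F hF a ha V hb hΓk
  have hsum : (∑ k, a k) ^ 2 = 32 * (∑ k : Fin m, ((R k : ℝ) + T k)) ^ 2 / (B.card : ℝ) := by
    simp only [hadef]
    rw [← Finset.mul_sum, mul_pow, Real.sq_sqrt (div_nonneg (by norm_num) hS.le)]
    field_simp
  rw [hsum] at hmain
  exact hmain

/-! ## §2. Cold-start equilibration of block-averaged loop strings from log-Sobolev(`ρ`) -/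

/-- ★★ **Cold-start equilibration of a block-averaged loop string from log-Sobolev(`ρ`)** (every `β'`, `B` nonempty, `Σ_k(R_k+T_k) > 0`):
`|E ∏_k W̄_(B,k)(U_(2+u)) − ∫ ∏_k W̄_(B,k) dμ_(β')| ≤ e^(−2ρu)·√(32(Σ_k(R_k+T_k))²·B_L/(#B·2ρ))`. [cite: BakryGentilLedoux2014, Thm 5.2.1] -/
theorem wilson_coldStart_blockLoopString_le_exp_of_logSobolev (L : ℕ) [NeZero L] (β' : ℝ) (m : ℕ) {ρ : ℝ} (hρ : 0 < ρ) (i j : Fin m → Fin 3)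
    (R T : Fin m → ℕ) (hRT : 0 < ∑ k, (R k + T k)) (B : Finset (Site 3 L)) (hB : B.Nonempty) (z : (GaugeConfig 3 L (Matrix.specialUnitaryGroup (Fin 2) ℂ)))
    (hLSgen : ∀ (f : (Edge 3 L × Fin 2 × Fin 2 × Bool → ℝ) → ℝ), ContDiff ℝ 3 f →
        let coords : GaugeConfig 3 L (Matrix.specialUnitaryGroup (Fin 2) ℂ) → (Edge 3 L × Fin 2 × Fin 2 × Bool → ℝ) :=
          fun V q => (fun z : ℂ => if q.2.2.2 then z.im else z.re)
            ((fundamentalRep (Fin 2) (V q.1) : Matrix (Fin 2) (Fin 2) ℂ) q.2.1 q.2.2.1)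
        let gen : GaugeConfig 3 L (Matrix.specialUnitaryGroup (Fin 2) ℂ) → ℝ := fun V =>
          (∑ i : Edge 3 L × Fin 2 × Fin 2 × Bool, fderiv ℝ f (coords V) (Pi.single i 1) *
              (fun z : ℂ => if i.2.2.2 then z.im else z.re)
                ((latticeLangevinDynamics (fundamentalLatticeRep 2) β').drift
                  (matrixConfig (fundamentalRep (Fin 2)) V) i.1 i.2.1 i.2.2.1) +
          1 / 2 * ∑ i : Edge 3 L × Fin 2 × Fin 2 × Bool, ∑ j : Edge 3 L × Fin 2 × Fin 2 × Bool,
            fderiv ℝ (fun z => fderiv ℝ f z (Pi.single i 1)) (coords V) (Pi.single j 1) *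
              ∑ n : Edge 3 L × NoiseIdx 2,
                (if n.1 = i.1 then (fun z : ℂ => if i.2.2.2 then z.im else z.re)
                  ((latticeLangevinDynamics (fundamentalLatticeRep 2) β').noise
                    (matrixConfig (fundamentalRep (Fin 2)) V) i.1 n.2 i.2.1 i.2.2.1) else 0) *
                (if n.1 = j.1 then (fun z : ℂ => if j.2.2.2 then z.im else z.re)
                  ((latticeLangevinDynamics (fundamentalLatticeRep 2) β').noise
                    (matrixConfig (fundamentalRep (Fin 2)) V) j.1 n.2 j.2.1 j.2.2.1) else 0))
        ρ * ((∫ V, f (coords V) ^ 2 * Real.log (f (coords V) ^ 2) ∂(wilsonMeasure (d := 3) (L := L) (fundamentalRep (Fin 2)) β')) -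
            (∫ V, f (coords V) ^ 2 ∂(wilsonMeasure (d := 3) (L := L) (fundamentalRep (Fin 2)) β')) *
              Real.log (∫ V, f (coords V) ^ 2 ∂(wilsonMeasure (d := 3) (L := L) (fundamentalRep (Fin 2)) β'))) ≤
          -∫ V, f (coords V) * gen V ∂(wilsonMeasure (d := 3) (L := L) (fundamentalRep (Fin 2)) β'))
    {Ω : Type} [MeasurableSpace Ω] {P : Measure Ω} [IsProbabilityMeasure P]
    {W : ℝ≥0 → Ω → (Edge 3 L × NoiseIdx 2 → ℝ)} (hW : IsFlatBrownian W P)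
    {U : ℝ≥0 → Ω → (GaugeConfig 3 L (Matrix.specialUnitaryGroup (Fin 2) ℂ))} (hU0 : ∀ ω, U 0 ω = z)
    (hU : (latticeLangevinDynamics (fundamentalLatticeRep 2) β').IsSolution (fundamentalRep (Fin 2)) hW.natFiltration P W U)
    (u : ℝ≥0) :
    |(∫ ω, (∏ k : Fin m, (((B.card : ℝ))⁻¹ * ∑ x ∈ B, wilsonLoop (fundamentalRep (Fin 2)) x (i k) (j k) (R k) (T k) (U ((2 : ℝ≥0) + u) ω))) ∂P) - ∫ V, (∏ k : Fin m, (((B.card : ℝ))⁻¹ * ∑ x ∈ B, wilsonLoop (fundamentalRep (Fin 2)) x (i k) (j k) (R k) (T k) V)) ∂(wilsonMeasure (d := 3) (L := L) (fundamentalRep (Fin 2)) β')| ≤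
      Real.exp (-(2 * ρ) * u) * Real.sqrt (32 * (∑ k : Fin m, ((R k : ℝ) + T k)) ^ 2 * (366 * |β'| * (L : ℝ) ^ 3 + 3 * Real.log (3 / 2) * (L : ℝ) ^ 3 + Real.log 2) / ((B.card : ℝ) * (2 * ρ))) := by
  classical
  haveI := secondCountableTopology_su2
  haveI := borelSpace_config L
  set μ : Measure (GaugeConfig 3 L (Matrix.specialUnitaryGroup (Fin 2) ℂ)) := (wilsonMeasure (d := 3) (L := L) (fundamentalRep (Fin 2)) β') with hμ
  haveI : IsProbabilityMeasure μ :=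
    isProbabilityMeasure_wilsonMeasure (d := 3) (L := L) (fundamentalRep (Fin 2)) (continuous_fundamentalRep (Fin 2)) β'
  have h2ρ : 0 < 2 * ρ := by positivity
  have hS : (0 : ℝ) < (B.card : ℝ) := by exact_mod_cast hB.card_pos
  have hS0 : (B.card : ℝ) ≠ 0 := hS.ne'
  have hRT' : (0 : ℝ) < (∑ k : Fin m, ((R k : ℝ) + T k)) := by
    have h : ((∑ k, (R k + T k) : ℕ) : ℝ) = (∑ k : Fin m, ((R k : ℝ) + T k)) := by push_cast; rfl
    rw [← h]; exact_mod_cast hRT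
  set co : (GaugeConfig 3 L (Matrix.specialUnitaryGroup (Fin 2) ℂ)) → (Edge 3 L × Fin 2 × Fin 2 × Bool → ℝ) := (fun (V : GaugeConfig 3 L (Matrix.specialUnitaryGroup (Fin 2) ℂ)) (q : Edge 3 L × Fin 2 × Fin 2 × Bool) => (fun z : ℂ => if q.2.2.2 then z.im else z.re) ((fundamentalRep (Fin 2) (V q.1) : Matrix (Fin 2) (Fin 2) ℂ) q.2.1 q.2.2.1)) with hco
  set F : Fin m → (Edge 3 L × Fin 2 × Fin 2 × Bool → ℝ) → ℝ := fun k => (fun y : (Edge 3 L × Fin 2 × Fin 2 × Bool → ℝ) => (2 * (B.card : ℝ))⁻¹ * ∑ x ∈ B, ((((((List.range (R k)).map (fun m : ℕ => ((Pi.single (i k) ((m : ℕ) : ZMod L) : Site 3 L), (i k), false)) ++ (List.range (T k)).map (fun m : ℕ => ((Pi.single (i k) (((R k) : ℕ) : ZMod L) : Site 3 L) + (Pi.single (j k) ((m : ℕ) : ZMod L) : Site 3 L), (j k), false)) ++ ((List.range (R k)).map (fun m : ℕ => ((Pi.single (j k) (((T k) : ℕ) : ZMod L) : Site 3 L) + (Pi.single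 (i k) ((m : ℕ) : ZMod L) : Site 3 L), (i k), true))).reverse ++ ((List.range (T k)).map (fun m : ℕ => ((Pi.single (j k) ((m : ℕ) : ZMod L) : Site 3 L), (j k), true))).reverse).map (fun q : Site 3 L × Fin 3 × Bool => ((x + q.1, q.2.1), q.2.2))).map (fun a : Edge 3 L × Bool => if a.2 then ((fun (ee : Edge 3 L) => Matrix.of fun (i' j' : Fin 2) => ((y (ee, i', j', false) : ℝ) : ℂ) + ((y (ee, i', j', true) : ℝ) : ℂ) * Complex.I) a.1)ᴴ else (fun (ee : Edge 3 L) => Matrix.of fun (i' j' : Fin 2) => ((y (ee, i', j', false) : ℝ) : ℂ) + ((y (ee, i', j', true) : ℝ) : ℂ) * Complex.I) a.1)).prod)).trace.re) with hFdef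
  have hfC : ContDiff ℝ 3 (fun y => ∏ k : Fin m, F k y) := contDiff_prod (fun k _ => contDiff_blockLoopAverage _ _ B)
  have hval : ∀ (k) (V : (GaugeConfig 3 L (Matrix.specialUnitaryGroup (Fin 2) ℂ))), F k (co V) = (((B.card : ℝ))⁻¹ * ∑ x ∈ B, wilsonLoop (fundamentalRep (Fin 2)) x (i k) (j k) (R k) (T k) V) :=
    fun k V => blockLoopAverage_coords_eq V (i k) (j k) (R k) (T k) B hB
  have hvalP : ∀ V : (GaugeConfig 3 L (Matrix.specialUnitaryGroup (Fin 2) ℂ)), (fun y => ∏ k : Fin m, F k y) (co V) = (∏ k : Fin m, (((B.card : ℝ))⁻¹ * ∑ x ∈ B, wilsonLoop (fundamentalRep (Fin 2)) x (i k) (j k) (R k) (T k) V)) :=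
    fun V => Finset.prod_congr rfl fun k _ => hval k V
  have hs : 0 < 32 * (∑ k : Fin m, ((R k : ℝ) + T k)) ^ 2 / (B.card : ℝ) := div_pos (mul_pos (by norm_num) (pow_pos hRT' 2)) hS
  have hmain : |(∫ ω, (fun y => ∏ k : Fin m, F k y) (co (U ((2 : ℝ≥0) + u) ω)) ∂P) - ∫ V, (fun y => ∏ k : Fin m, F k y) (co V) ∂μ| ≤
      Real.exp (-(2 * ρ) * u) * Real.sqrt ((32 * (∑ k : Fin m, ((R k : ℝ) + T k)) ^ 2 / (B.card : ℝ)) * (366 * |β'| * (L : ℝ) ^ 3 + 3 * Real.log (3 / 2) * (L : ℝ) ^ 3 + Real.log 2) / (2 * ρ)) :=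
    wilson_coldStart_smooth_le_exp_of_logSobolev_explicit L β' (fun y => ∏ k : Fin m, F k y) hρ hfC hs hLSgen hW z hU0 hU u
      (wilson_blockLoopString_carre_le L β' m i j R T B hB)
  have hEP : ∫ ω, (fun y => ∏ k : Fin m, F k y) (co (U ((2 : ℝ≥0) + u) ω)) ∂P = ∫ ω, (∏ k : Fin m, (((B.card : ℝ))⁻¹ * ∑ x ∈ B, wilsonLoop (fundamentalRep (Fin 2)) x (i k) (j k) (R k) (T k) (U ((2 : ℝ≥0) + u) ω))) ∂P :=
    integral_congr_ae (ae_of_all _ fun ω => hvalP _)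
  have hEμ : ∫ V, (fun y => ∏ k : Fin m, F k y) (co V) ∂μ = ∫ V, (∏ k : Fin m, (((B.card : ℝ))⁻¹ * ∑ x ∈ B, wilsonLoop (fundamentalRep (Fin 2)) x (i k) (j k) (R k) (T k) V)) ∂μ :=
    integral_congr_ae (ae_of_all _ fun V => hvalP V)
  have e2 : (32 * (∑ k : Fin m, ((R k : ℝ) + T k)) ^ 2 / (B.card : ℝ)) * (366 * |β'| * (L : ℝ) ^ 3 + 3 * Real.log (3 / 2) * (L : ℝ) ^ 3 + Real.log 2) / (2 * ρ) =
      32 * (∑ k : Fin m, ((R k : ℝ) + T k)) ^ 2 * (366 * |β'| * (L : ℝ) ^ 3 + 3 * Real.log (3 / 2) * (L : ℝ) ^ 3 + Real.log 2) / ((B.card : ℝ) * (2 * ρ)) := by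
    field_simp
  rw [hEP, hEμ, e2] at hmain
  exact hmain

/-- ★★ **Block form from log-Sobolev(`ρ`)**: `≤ e^(−2ρu)·(Σ_k(R_k+T_k))·√(16(366|β'|+3)(L³/#B)/ρ)` — only `β'`, `ρ` and the NUMBER OF BLOCKS `L³/#B`.
[cite: BakryGentilLedoux2014, Thm 5.2.1] -/
theorem wilson_coldStart_blockLoopString_le_blocks_of_logSobolev (L : ℕ) [NeZero L] (β' : ℝ) (m : ℕ) (i j : Fin m → Fin 3) {ρ : ℝ} (hρ : 0 < ρ)
    (R T : Fin m → ℕ) (hRT : 0 < ∑ k, (R k + T k)) (B : Finset (Site 3 L)) (hB : B.Nonempty) (z : (GaugeConfig 3 L (Matrix.specialUnitaryGroup (Fin 2) ℂ)))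
    (hLSgen : ∀ (f : (Edge 3 L × Fin 2 × Fin 2 × Bool → ℝ) → ℝ), ContDiff ℝ 3 f →
        let coords : GaugeConfig 3 L (Matrix.specialUnitaryGroup (Fin 2) ℂ) → (Edge 3 L × Fin 2 × Fin 2 × Bool → ℝ) :=
          fun V q => (fun z : ℂ => if q.2.2.2 then z.im else z.re)
            ((fundamentalRep (Fin 2) (V q.1) : Matrix (Fin 2) (Fin 2) ℂ) q.2.1 q.2.2.1)
        let gen : GaugeConfig 3 L (Matrix.specialUnitaryGroup (Fin 2) ℂ) → ℝ := fun V =>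
          (∑ i : Edge 3 L × Fin 2 × Fin 2 × Bool, fderiv ℝ f (coords V) (Pi.single i 1) *
              (fun z : ℂ => if i.2.2.2 then z.im else z.re)
                ((latticeLangevinDynamics (fundamentalLatticeRep 2) β').drift
                  (matrixConfig (fundamentalRep (Fin 2)) V) i.1 i.2.1 i.2.2.1) +
          1 / 2 * ∑ i : Edge 3 L × Fin 2 × Fin 2 × Bool, ∑ j : Edge 3 L × Fin 2 × Fin 2 × Bool,
            fderiv ℝ (fun z => fderiv ℝ f z (Pi.single i 1)) (coords V) (Pi.single j 1) *
              ∑ n : Edge 3 L × NoiseIdx 2,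
                (if n.1 = i.1 then (fun z : ℂ => if i.2.2.2 then z.im else z.re)
                  ((latticeLangevinDynamics (fundamentalLatticeRep 2) β').noise
                    (matrixConfig (fundamentalRep (Fin 2)) V) i.1 n.2 i.2.1 i.2.2.1) else 0) *
                (if n.1 = j.1 then (fun z : ℂ => if j.2.2.2 then z.im else z.re)
                  ((latticeLangevinDynamics (fundamentalLatticeRep 2) β').noise
                    (matrixConfig (fundamentalRep (Fin 2)) V) j.1 n.2 j.2.1 j.2.2.1) else 0))
        ρ * ((∫ V, f (coords V) ^ 2 * Real.log (f (coords V) ^ 2) ∂(wilsonMeasure (d := 3) (L := L) (fundamentalRep (Fin 2)) β')) -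
            (∫ V, f (coords V) ^ 2 ∂(wilsonMeasure (d := 3) (L := L) (fundamentalRep (Fin 2)) β')) *
              Real.log (∫ V, f (coords V) ^ 2 ∂(wilsonMeasure (d := 3) (L := L) (fundamentalRep (Fin 2)) β'))) ≤
          -∫ V, f (coords V) * gen V ∂(wilsonMeasure (d := 3) (L := L) (fundamentalRep (Fin 2)) β'))
    {Ω : Type} [MeasurableSpace Ω] {P : Measure Ω} [IsProbabilityMeasure P]
    {W : ℝ≥0 → Ω → (Edge 3 L × NoiseIdx 2 → ℝ)} (hW : IsFlatBrownian W P)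
    {U : ℝ≥0 → Ω → (GaugeConfig 3 L (Matrix.specialUnitaryGroup (Fin 2) ℂ))} (hU0 : ∀ ω, U 0 ω = z)
    (hU : (latticeLangevinDynamics (fundamentalLatticeRep 2) β').IsSolution (fundamentalRep (Fin 2)) hW.natFiltration P W U)
    (u : ℝ≥0) :
    |(∫ ω, (∏ k : Fin m, (((B.card : ℝ))⁻¹ * ∑ x ∈ B, wilsonLoop (fundamentalRep (Fin 2)) x (i k) (j k) (R k) (T k) (U ((2 : ℝ≥0) + u) ω))) ∂P) - ∫ V, (∏ k : Fin m, (((B.card : ℝ))⁻¹ * ∑ x ∈ B, wilsonLoop (fundamentalRep (Fin 2)) x (i k) (j k) (R k) (T k) V)) ∂(wilsonMeasure (d := 3) (L := L) (fundamentalRep (Fin 2)) β')| ≤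
      Real.exp (-(2 * ρ) * u) * ((∑ k : Fin m, ((R k : ℝ) + T k)) * Real.sqrt (16 * (366 * |β'| + 3) * ((L : ℝ) ^ 3 / (B.card : ℝ)) / ρ)) := by
  have h2ρ : 0 < 2 * ρ := by positivity
  have hS : (0 : ℝ) < (B.card : ℝ) := by exact_mod_cast hB.card_pos
  have hRT' : (0 : ℝ) < (∑ k : Fin m, ((R k : ℝ) + T k)) := by
    have h : ((∑ k, (R k + T k) : ℕ) : ℝ) = (∑ k : Fin m, ((R k : ℝ) + T k)) := by push_cast; rfl
    rw [← h]; exact_mod_cast hRT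
  have h := wilson_coldStart_blockLoopString_le_exp_of_logSobolev L β' m hρ i j R T hRT B hB z hLSgen hW hU0 hU u
  refine h.trans (mul_le_mul_of_nonneg_left ?_ (Real.exp_pos _).le)
  obtain ⟨S, hSdef⟩ : ∃ S : ℝ, (∑ k : Fin m, ((R k : ℝ) + T k)) = S := ⟨_, rfl⟩
  rw [hSdef] at hRT' ⊢
  have hL1 : (1 : ℝ) ≤ (L : ℝ) := by exact_mod_cast Nat.one_le_iff_ne_zero.2 (NeZero.ne L)
  have hL3 : (1 : ℝ) ≤ (L : ℝ) ^ 3 := one_le_pow₀ hL1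
  have hL30 : (0 : ℝ) < (L : ℝ) ^ 3 := by positivity
  have h32 : Real.log (3 / 2 : ℝ) ≤ 1 / 2 := by
    have := Real.log_le_sub_one_of_pos (by norm_num : (0 : ℝ) < 3 / 2); linarith
  have h2 : Real.log (2 : ℝ) ≤ 1 := by
    have := Real.log_le_sub_one_of_pos (by norm_num : (0 : ℝ) < 2); linarith
  have hBL : (366 * |β'| * (L : ℝ) ^ 3 + 3 * Real.log (3 / 2) * (L : ℝ) ^ 3 + Real.log 2) ≤ (366 * |β'| + 3) * (L : ℝ) ^ 3 := by
    nlinarith [mul_le_mul_of_nonneg_right h32 hL30.le, abs_nonneg β']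
  have hq : 32 * S ^ 2 * (366 * |β'| * (L : ℝ) ^ 3 + 3 * Real.log (3 / 2) * (L : ℝ) ^ 3 + Real.log 2) / ((B.card : ℝ) * (2 * ρ)) ≤ (S * Real.sqrt (16 * (366 * |β'| + 3) * ((L : ℝ) ^ 3 / (B.card : ℝ)) / ρ)) ^ 2 := by
    rw [mul_pow, Real.sq_sqrt (div_nonneg (mul_nonneg (by positivity) (div_nonneg hL30.le hS.le)) hρ.le)]
    rw [div_le_iff₀ (mul_pos hS h2ρ)]
    have hS0 : (B.card : ℝ) ≠ 0 := hS.ne'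
    have hρ0 : ρ ≠ 0 := hρ.ne'
    have e : S ^ 2 * (16 * (366 * |β'| + 3) * ((L : ℝ) ^ 3 / (B.card : ℝ)) / ρ) * ((B.card : ℝ) * (2 * ρ)) = 32 * S ^ 2 * ((366 * |β'| + 3) * (L : ℝ) ^ 3) := by
      field_simp
      ring
    rw [e]
    exact mul_le_mul_of_nonneg_left hBL (by positivity)
  exact (Real.sqrt_le_sqrt hq).trans (le_of_eq (Real.sqrt_sq (mul_nonneg hRT'.le (Real.sqrt_nonneg _))))

/-- ★★★ **Block loop strings at `|β'| < 1/12`, UNCONDITIONALLY** (g26's volume-uniform log-Sobolev constant `ρ = (1−12|β'|)/2`): for every `L`, every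
nonempty `B`, every deterministic start, every solution and every `u ≥ 0`,
`|E ∏_k W̄_(B,k)(U_(2+u)) − ∫∏_k W̄_(B,k) dμ_(β')| ≤ e^(−(1−12|β'|)u)·(Σ_k(R_k+T_k))·√(32(366|β'|+3)(L³/#B)/(1−12|β'|))`. [cite: ShenZhuZhu2022, §4 Theorem 4.2] -/
theorem wilson_coldStart_blockLoopString_le_blocks (L : ℕ) [NeZero L] (β' : ℝ) (hβ : |β'| < 1 / 12) (m : ℕ) (i j : Fin m → Fin 3)
    (R T : Fin m → ℕ) (hRT : 0 < ∑ k, (R k + T k)) (B : Finset (Site 3 L)) (hB : B.Nonempty) (z : (GaugeConfig 3 L (Matrix.specialUnitaryGroup (Fin 2) ℂ)))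
    {Ω : Type} [MeasurableSpace Ω] {P : Measure Ω} [IsProbabilityMeasure P]
    {W : ℝ≥0 → Ω → (Edge 3 L × NoiseIdx 2 → ℝ)} (hW : IsFlatBrownian W P)
    {U : ℝ≥0 → Ω → (GaugeConfig 3 L (Matrix.specialUnitaryGroup (Fin 2) ℂ))} (hU0 : ∀ ω, U 0 ω = z)
    (hU : (latticeLangevinDynamics (fundamentalLatticeRep 2) β').IsSolution (fundamentalRep (Fin 2)) hW.natFiltration P W U)
    (u : ℝ≥0) :
    |(∫ ω, (∏ k : Fin m, (((B.card : ℝ))⁻¹ * ∑ x ∈ B, wilsonLoop (fundamentalRep (Fin 2)) x (i k) (j k) (R k) (T k) (U ((2 : ℝ≥0) + u) ω))) ∂P) - ∫ V, (∏ k : Fin m, (((B.card : ℝ))⁻¹ * ∑ x ∈ B, wilsonLoop (fundamentalRep (Fin 2)) x (i k) (j k) (R k) (T k) V)) ∂(wilsonMeasure (d := 3) (L := L) (fundamentalRep (Fin 2)) β')| ≤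
      Real.exp (-(1 - 12 * |β'|) * u) * ((∑ k : Fin m, ((R k : ℝ) + T k)) * Real.sqrt (32 * (366 * |β'| + 3) * ((L : ℝ) ^ 3 / (B.card : ℝ)) / (1 - 12 * |β'|))) := by
  have hρ : 0 < (1 - 12 * |β'|) / 2 := by linarith
  have h := wilson_coldStart_blockLoopString_le_blocks_of_logSobolev L β' m i j hρ R T hRT B hB z
    (fun f hf => wilson_generatorLogSobolev_uniform L β' hβ f hf) hW hU0 hU u
  have e1 : -(2 * ((1 - 12 * |β'|) / 2)) * (u : ℝ) = -(1 - 12 * |β'|) * u := by ring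
  have e2 : 16 * (366 * |β'| + 3) * ((L : ℝ) ^ 3 / (B.card : ℝ)) / ((1 - 12 * |β'|) / 2) = 32 * (366 * |β'| + 3) * ((L : ℝ) ^ 3 / (B.card : ℝ)) / (1 - 12 * |β'|) := by
    rw [div_div_eq_mul_div]; ring
  rw [e1, e2] at h
  exact h

/-! ## §3. (ULS) ⇒ near-uniform equilibration of block-averaged loop strings -/

/-- ★★★ **(ULS) alone ⇒ near-uniform cold-start equilibration of BLOCK-averaged loop strings** — the crux's observable shape at the smooth level: under the
route's K-uniform log-Sobolev hypothesis, `∃γ₁>0 ∀F, 0<γ≤γ₁ ⇒ ∃c>0 ∃K₀ ∀K≥K₀`, for every nonempty block `B` of base points of the `K`-th lattice, every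
family of rectangles with `Σ_k(R_k+T_k) > 0`, every solution at `β'_K` from any deterministic start and every lattice time `u ≥ 0`:
`|E ∏_k W̄_(B,k)(U_(2+u)) − ∫∏_k W̄_(B,k) dμ_K| ≤ e^(−2cε_K u)·(Σ_k(R_k+T_k))·√(16(366β'_K+3)(L_K³/#B)/(cε_K))`.  With unit PHYSICAL blocks
`L_K³/#B = ℓ³` (fixed) and physical loops `R_k+T_k ≍ ε_K⁻¹` the `δ`-threshold in physical time `ε_K(2+u)` is `O(log(1/ε_K))`. [cite: BakryGentilLedoux2014, Thm 5.2.1] -/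
theorem nearUniform_blockLoopString_coldStart_of_uniformLogSobolev
    (hULS : ∃ γ₁ : ℝ, 0 < γ₁ ∧ ∀ (F : T3ContinuumYM3Torus.T3Family) (γ : ℝ), 0 < γ → γ ≤ γ₁ →
      ∃ c : ℝ, 0 < c ∧ ∃ K₀ : ℕ, ∀ K : ℕ, K₀ ≤ K →
        ∀ (f : (Edge 3 ((F.P K).sitesPerDir 0) × Fin 2 × Fin 2 × Bool → ℝ) → ℝ), ContDiff ℝ 3 f →
        let coords : GaugeConfig 3 ((F.P K).sitesPerDir 0) (Matrix.specialUnitaryGroup (Fin 2) ℂ) →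
            (Edge 3 ((F.P K).sitesPerDir 0) × Fin 2 × Fin 2 × Bool → ℝ) :=
          fun V q => (fun z : ℂ => if q.2.2.2 then z.im else z.re)
            ((fundamentalRep (Fin 2) (V q.1) : Matrix (Fin 2) (Fin 2) ℂ) q.2.1 q.2.2.1)
        let gen : GaugeConfig 3 ((F.P K).sitesPerDir 0) (Matrix.specialUnitaryGroup (Fin 2) ℂ) → ℝ := fun V =>
          (∑ i : Edge 3 ((F.P K).sitesPerDir 0) × Fin 2 × Fin 2 × Bool, fderiv ℝ f (coords V) (Pi.single i 1) *
              (fun z : ℂ => if i.2.2.2 then z.im else z.re)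
                ((latticeLangevinDynamics (fundamentalLatticeRep 2) ((γ * (F.P K).eps)⁻¹ / 2)).drift
                  (matrixConfig (fundamentalRep (Fin 2)) V) i.1 i.2.1 i.2.2.1) +
          1 / 2 * ∑ i : Edge 3 ((F.P K).sitesPerDir 0) × Fin 2 × Fin 2 × Bool,
            ∑ j : Edge 3 ((F.P K).sitesPerDir 0) × Fin 2 × Fin 2 × Bool,
            fderiv ℝ (fun z => fderiv ℝ f z (Pi.single i 1)) (coords V) (Pi.single j 1) *
              ∑ n : Edge 3 ((F.P K).sitesPerDir 0) × NoiseIdx 2,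
                (if n.1 = i.1 then (fun z : ℂ => if i.2.2.2 then z.im else z.re)
                  ((latticeLangevinDynamics (fundamentalLatticeRep 2) ((γ * (F.P K).eps)⁻¹ / 2)).noise
                    (matrixConfig (fundamentalRep (Fin 2)) V) i.1 n.2 i.2.1 i.2.2.1) else 0) *
                (if n.1 = j.1 then (fun z : ℂ => if j.2.2.2 then z.im else z.re)
                  ((latticeLangevinDynamics (fundamentalLatticeRep 2) ((γ * (F.P K).eps)⁻¹ / 2)).noise
                    (matrixConfig (fundamentalRep (Fin 2)) V) j.1 n.2 j.2.1 j.2.2.1) else 0))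
        c * (F.P K).eps *
            ((∫ V, f (coords V) ^ 2 * Real.log (f (coords V) ^ 2)
                ∂(wilsonMeasure (d := 3) (L := (F.P K).sitesPerDir 0) (fundamentalRep (Fin 2)) ((γ * (F.P K).eps)⁻¹ / 2))) -
              (∫ V, f (coords V) ^ 2
                ∂(wilsonMeasure (d := 3) (L := (F.P K).sitesPerDir 0) (fundamentalRep (Fin 2)) ((γ * (F.P K).eps)⁻¹ / 2))) *
                Real.log (∫ V, f (coords V) ^ 2
                  ∂(wilsonMeasure (d := 3) (L := (F.P K).sitesPerDir 0) (fundamentalRep (Fin 2)) ((γ * (F.P K).eps)⁻¹ / 2)))) ≤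
          -∫ V, f (coords V) * gen V
            ∂(wilsonMeasure (d := 3) (L := (F.P K).sitesPerDir 0) (fundamentalRep (Fin 2)) ((γ * (F.P K).eps)⁻¹ / 2))) :
    ∃ γ₁ : ℝ, 0 < γ₁ ∧ ∀ (F : T3ContinuumYM3Torus.T3Family) (γ : ℝ), 0 < γ → γ ≤ γ₁ →
      ∃ c : ℝ, 0 < c ∧ ∃ K₀ : ℕ, ∀ K : ℕ, K₀ ≤ K →
        ∀ (B : Finset (Site 3 ((F.P K).sitesPerDir 0))), B.Nonempty →
        ∀ (m : ℕ) (i j : Fin m → Fin 3) (R T : Fin m → ℕ), 0 < ∑ k, (R k + T k) →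
        ∀ (z : GaugeConfig 3 ((F.P K).sitesPerDir 0) (Matrix.specialUnitaryGroup (Fin 2) ℂ))
          (Ω : Type) (mΩ : MeasurableSpace Ω) (P : Measure Ω) (hP : IsProbabilityMeasure P)
          (W : ℝ≥0 → Ω → (Edge 3 ((F.P K).sitesPerDir 0) × NoiseIdx 2 → ℝ)) (hW : IsFlatBrownian W P)
          (U : ℝ≥0 → Ω → GaugeConfig 3 ((F.P K).sitesPerDir 0) (Matrix.specialUnitaryGroup (Fin 2) ℂ)),
          (∀ ω, U 0 ω = z) →
          (latticeLangevinDynamics (fundamentalLatticeRep 2) ((γ * (F.P K).eps)⁻¹ / 2)).IsSolution (fundamentalRep (Fin 2)) hW.natFiltration P W U →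
          ∀ u : ℝ≥0,
            |(∫ ω, (∏ k : Fin m, (((B.card : ℝ))⁻¹ * ∑ x ∈ B, wilsonLoop (fundamentalRep (Fin 2)) x (i k) (j k) (R k) (T k) (U ((2 : ℝ≥0) + u) ω))) ∂P) -
                ∫ V, (∏ k : Fin m, (((B.card : ℝ))⁻¹ * ∑ x ∈ B, wilsonLoop (fundamentalRep (Fin 2)) x (i k) (j k) (R k) (T k) V)) ∂(wilsonMeasure (d := 3) (L := ((F.P K).sitesPerDir 0)) (fundamentalRep (Fin 2)) ((γ * (F.P K).eps)⁻¹ / 2))| ≤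
              Real.exp (-(2 * (c * (F.P K).eps)) * u) *
                ((∑ k : Fin m, ((R k : ℝ) + T k)) * Real.sqrt (16 * (366 * |(γ * (F.P K).eps)⁻¹ / 2| + 3) * (((((F.P K).sitesPerDir 0) : ℕ) : ℝ) ^ 3 / (B.card : ℝ)) / (c * (F.P K).eps))) := by
  obtain ⟨γ₁, hγ₁, h⟩ := hULS
  refine ⟨γ₁, hγ₁, fun F γ hγ hγ1 => ?_⟩
  obtain ⟨c, hc, K₀, hK⟩ := h F γ hγ hγ1
  refine ⟨c, hc, K₀, fun K hKK B hB m i j R T hRT z Ω mΩ P hP W hW U hU0 hU u => ?_⟩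
  have hρ : 0 < c * (F.P K).eps := mul_pos hc (F.P K).eps_pos
  exact wilson_coldStart_blockLoopString_le_blocks_of_logSobolev ((F.P K).sitesPerDir 0) ((γ * (F.P K).eps)⁻¹ / 2) m i j hρ R T hRT B hB z (hK K hKK) hW hU0 hU u

end Summit.QuantumFields.YangMills.Theorems.ColdStartUniversality
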